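import Summits.ResolutionOfSingularities.ResolutionOfSingularities.Theorems.FrobeniusLadderFInjectiveMacaulayficationX2Cubic4VertexFull
import Summits.ResolutionOfSingularities.ResolutionOfSingularities.Theorems.FrobeniusLadderFInjectiveMacaulayficationX2C31Specimen
import HarnessLib

/-!
# CLASS-LEVEL VERTEX FULLNESS FOR `x² + X_i³ + X_j³ + B` (`B` free of `x, X_i, X_j`), EVERY PRIME `p ∉ {2, 3}` — and the (C31) bed `x² + y³ + u³ + t³ + s³ + y²u` is FULL at EVERY closed point
# (crux `FInjectiveMacaulayfication` stmt-ResolutionOfSingularities-15315, chain w45a; completes the (C′) row ✓/⧗ `X2C31ClassRow.tStep_row_C31` with the INPUT-side legality «the base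
# germ is FULL»; res-L1-w45a-plan-1 ANSWER 00:15Z «vertex FULLness per bed» — here for a whole sub-class at once; seat res-L1-w45a-lead-1 g11)

[OURS · L1 W4.5a] Support file (`--supports stmt-ResolutionOfSingularities-15315 --as helper`); def-free; UNCONDITIONAL; no named fact; NOT a statement of any manuscript. AI-written
(AI review is weaker than expert review).

The two-stage `p`-uniform derivative certificate of ✓p678024 `X2Cubic4VertexFull` (`∂₄^{p−1}`, then `∂_i^{3a}`, `∂_j^{3b}` with `a + b = (p−1)/2`, `3a, 3b ≤ p − 1`) only ever
differentiates in `x` and in TWO pure-cube variables; so it certifies `1 ∈ (T)` for every `∂`-stable `T ∋ f^{p−1}` whenever `f = X₄² + X_i³ + X_j³ + B` with `∂₄B = ∂_iB = ∂_jB = 0`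
— whatever the cubic `B` in the remaining variables is (smooth or not).
* §1 index-generic stage 2: `iterate_pderiv_r_pow_eq_zero`, `iterate_pderiv_r_pow_self`, `iterate_iterate_c_pow` (indices `i ≠ j`).
* §2 ★★ `hcert_of_two_cubes`; `clause_of_two_cubes` (the FULL clause at EVERY maximal ideal of `k[X]/(f)`, via ✓ `TCaFloorOneFull.clause_at_maximal_of_derivative_certificate`);
  ★★ `fullCl_stalk_of_two_cubes` (`f` prime ⇒ `FullCl p 𝒪_{Y,y}` at every closed point `y`).
* §3 ★★★ `fullCl_stalk_C31` / `fullCl_Spec_stalk_vertex_C31`: the (C31) bed is FULL at every closed point, in particular at its vertex, for every `p ∉ {2,3}`.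
[cite: Fedder1983, Thm. 1.12 (context)] [folklore computation]
-/

-- single-problem summit: the doubled namespace component is forced
set_option linter.dupNamespace false

noncomputable section

open MvPolynomial

namespace Summit.ResolutionOfSingularities.ResolutionOfSingularities.Theorems.FInjectiveMacaulayfication.X2TwoCubesVertexFull

open Summit.ResolutionOfSingularities.ResolutionOfSingularities.Theorems.FInjectiveMacaulayfication
open AlgebraicGeometry SliceableCentre X2Cubic4VertexFull

variable (k : Type) [Field k]

/-! ## §1 Index-generic stage 2 -/

/-- `∂_j^{3b}` kills `X_i^e · r^m` for `m < b` (`r = X_j³ + r′`, `∂_j r′ = 0`, `i ≠ j`). [OURS · vanishing] -/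
theorem iterate_pderiv_r_pow_eq_zero (i j : Fin 5) (hij : i ≠ j) (b m e : ℕ) (hm : m < b) (r r' : MvPolynomial (Fin 5) k) (hr : r = X j ^ 3 + r')
    (hr'j : pderiv j r' = 0) : (fun q => pderiv j q)^[3 * b] (X i ^ e * r ^ m) = 0 := by
  have hcof : ∀ n : ℕ, pderiv j (X i ^ e * r' ^ n : MvPolynomial (Fin 5) k) = 0 := fun n => by
    rw [Derivation.leibniz, Derivation.leibniz_pow, Derivation.leibniz_pow, hr'j, pderiv_X_of_ne hij]
    simp
  have hexp : X i ^ e * r ^ m =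
      (Finset.range (m + 1)).sum fun l => (m.choose l : MvPolynomial (Fin 5) k) * (X j ^ (3 * l) * (X i ^ e * r' ^ (m - l))) := by
    rw [hr, add_pow, Finset.mul_sum]
    refine Finset.sum_congr rfl fun l _ => ?_
    rw [← pow_mul]
    ring
  rw [hexp, iterate_pderiv_finset_sum]
  refine Finset.sum_eq_zero fun l hl => ?_
  rw [iterate_pderiv_natCast_mul, X2Cubic4FloorFullCert.iterate_pderiv_X_pow_mul j _ (hcof _) (3 * b) (3 * l),
    (Nat.descFactorial_eq_zero_iff_lt).mpr (by have := Finset.mem_range.mp hl; omega)]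
  simp

/-- `∂_j^{3b}(X_i^e · r^b) = (3b)! · X_i^e` (`r = X_j³ + r′`, `∂_j r′ = 0`, `i ≠ j`). [OURS · the survivor] -/
theorem iterate_pderiv_r_pow_self (i j : Fin 5) (hij : i ≠ j) (b e : ℕ) (r r' : MvPolynomial (Fin 5) k) (hr : r = X j ^ 3 + r') (hr'j : pderiv j r' = 0) :
    (fun q => pderiv j q)^[3 * b] (X i ^ e * r ^ b) = ((3 * b).factorial : MvPolynomial (Fin 5) k) * X i ^ e := by
  have hcof : ∀ n : ℕ, pderiv j (X i ^ e * r' ^ n : MvPolynomial (Fin 5) k) = 0 := fun n => by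
    rw [Derivation.leibniz, Derivation.leibniz_pow, Derivation.leibniz_pow, hr'j, pderiv_X_of_ne hij]
    simp
  have hexp : X i ^ e * r ^ b =
      (Finset.range (b + 1)).sum fun l => (b.choose l : MvPolynomial (Fin 5) k) * (X j ^ (3 * l) * (X i ^ e * r' ^ (b - l))) := by
    rw [hr, add_pow, Finset.mul_sum]
    refine Finset.sum_congr rfl fun l _ => ?_
    rw [← pow_mul]
    ring
  rw [hexp, iterate_pderiv_finset_sum, Finset.sum_eq_single b]
  · rw [iterate_pderiv_natCast_mul, X2Cubic4FloorFullCert.iterate_pderiv_X_pow_mul j _ (hcof _) (3 * b) (3 * b), Nat.descFactorial_self, Nat.sub_self, Nat.sub_self,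
      Nat.choose_self]
    simp
  · intro l hl hne
    rw [iterate_pderiv_natCast_mul, X2Cubic4FloorFullCert.iterate_pderiv_X_pow_mul j _ (hcof _) (3 * b) (3 * l),
      (Nat.descFactorial_eq_zero_iff_lt).mpr (by have := Finset.mem_range.mp hl; omega)]
    simp
  · intro hnot
    exact absurd (Finset.mem_range.mpr (Nat.lt_succ_self b)) hnot

/-- ★ **Stage 2, indices `i ≠ j`: `∂_j^{3b}(∂_i^{3a}(c^h)) = C(h,a)·(3a)!·(3b)!`** for `c = X_i³ + r`, `r = X_j³ + r′`, `∂_i r = 0`, `∂_j r′ = 0`, `a + b = h`. [folklore computation] -/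
theorem iterate_iterate_c_pow (i j : Fin 5) (hij : i ≠ j) (h a b : ℕ) (hab : a + b = h) (c r r' : MvPolynomial (Fin 5) k) (hc : c = X i ^ 3 + r)
    (hr : r = X j ^ 3 + r') (hri : pderiv i r = 0) (hr'j : pderiv j r' = 0) :
    (fun q => pderiv j q)^[3 * b] ((fun q => pderiv i q)^[3 * a] (c ^ h)) =
      ((h.choose a * (3 * a).factorial * (3 * b).factorial : ℕ) : MvPolynomial (Fin 5) k) := by
  have hrpow : ∀ m : ℕ, pderiv i (r ^ m) = 0 := fun m => by rw [Derivation.leibniz_pow, hri, smul_zero, smul_zero]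
  have hexp : c ^ h = (Finset.range (h + 1)).sum fun l => (h.choose l : MvPolynomial (Fin 5) k) * (X i ^ (3 * l) * r ^ (h - l)) := by
    rw [hc, add_pow]
    refine Finset.sum_congr rfl fun l _ => ?_
    rw [← pow_mul]
    ring
  rw [hexp, iterate_pderiv_finset_sum, iterate_pderiv_finset_sum, Finset.sum_eq_single a]
  · rw [iterate_pderiv_natCast_mul, X2Cubic4FloorFullCert.iterate_pderiv_X_pow_mul i _ (hrpow _) (3 * a) (3 * a), Nat.descFactorial_self, Nat.sub_self,
      show h - a = b by omega, iterate_pderiv_natCast_mul, iterate_pderiv_natCast_mul, iterate_pderiv_r_pow_self k i j hij b 0 r r' hr hr'j, pow_zero, mul_one]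
    push_cast
    ring
  · intro l hl hne
    rw [iterate_pderiv_natCast_mul, X2Cubic4FloorFullCert.iterate_pderiv_X_pow_mul i _ (hrpow _) (3 * a) (3 * l), iterate_pderiv_natCast_mul, iterate_pderiv_natCast_mul]
    rcases lt_or_gt_of_ne hne with hlt | hgt
    · rw [(Nat.descFactorial_eq_zero_iff_lt).mpr (by omega)]
      simp
    · have hl' := Finset.mem_range.mp hl
      rw [iterate_pderiv_r_pow_eq_zero k i j hij b (h - l) (3 * l - 3 * a) (by omega) r r' hr hr'j]
      simp
  · intro hnot
    exact absurd (Finset.mem_range.mpr (by omega : a < h + 1)) hnot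

/-! ## §2 The class-level certificate and FULLness at every closed point -/

/-- ★★ **THE `p`-UNIFORM DERIVATIVE CERTIFICATE FOR `f = X₄² + X_i³ + X_j³ + B`** (`i ≠ j`, both `≠ 4`, `∂₄B = ∂_iB = ∂_jB = 0`; every prime `p ∉ {2,3}`, every field of
characteristic `p`): every `∂`-stable `T ∋ f^{p−1}` has `1 ∈ (T)`. [OURS; cite: Fedder1983, Thm. 1.12 (context)] -/
theorem hcert_of_two_cubes (p : ℕ) [Fact p.Prime] [CharP k p] (hp2 : p ≠ 2) (hp3 : p ≠ 3) (i j : Fin 5) (hij : i ≠ j) (hi4 : i ≠ 4) (hj4 : j ≠ 4)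
    (B : MvPolynomial (Fin 5) k) (hB4 : pderiv 4 B = 0) (hBi : pderiv i B = 0) (hBj : pderiv j B = 0)
    (f : MvPolynomial (Fin 5) k) (hf : f = X 4 ^ 2 + X i ^ 3 + X j ^ 3 + B) :
    ∀ T : Set (MvPolynomial (Fin 5) k), f ^ (p - 1) ∈ T → (∀ s ∈ T, ∀ i : Fin 5, pderiv i s ∈ T) → (1 : MvPolynomial (Fin 5) k) ∈ Ideal.span T := by
  intro T hfT hT
  have hp : p.Prime := Fact.out
  obtain ⟨hab, h3a, h3b, hh⟩ := exponent_arith p hp hp2 hp3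
  -- stage 1
  have hf' : f = X 4 ^ 2 + (X i ^ 3 + (X j ^ 3 + B)) := by rw [hf]; ring
  have hc4 : pderiv 4 (X i ^ 3 + (X j ^ 3 + B) : MvPolynomial (Fin 5) k) = 0 := by
    rw [map_add, map_add, Derivation.leibniz_pow, Derivation.leibniz_pow, pderiv_X_of_ne hi4, pderiv_X_of_ne hj4, hB4]
    simp
  have hcI := c_pow_mem k p hp2 f _ hf' hc4 T hfT hT
  -- stage 2
  have hri : pderiv i (X j ^ 3 + B : MvPolynomial (Fin 5) k) = 0 := by
    rw [map_add, Derivation.leibniz_pow, pderiv_X_of_ne hij.symm, hBi]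
    simp
  have hD := iterate_span_pderiv_mem k T hT j (3 * ((p - 1) / 3))
    (iterate_span_pderiv_mem k T hT i (3 * ((p - 1) / 2 - (p - 1) / 3)) hcI)
  rw [iterate_iterate_c_pow k i j hij ((p - 1) / 2) ((p - 1) / 2 - (p - 1) / 3) ((p - 1) / 3) hab _ (X j ^ 3 + B) B rfl rfl hri hBj] at hD
  have hN : ((((p - 1) / 2).choose ((p - 1) / 2 - (p - 1) / 3) * (3 * ((p - 1) / 2 - (p - 1) / 3)).factorial * (3 * ((p - 1) / 3)).factorial : ℕ) : k) ≠ 0 := by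
    rw [Nat.cast_mul, Nat.cast_mul]
    exact mul_ne_zero (mul_ne_zero (choose_cast_ne_zero k p _ _ (by omega) hh) (factorial_cast_ne_zero k p _ h3a)) (factorial_cast_ne_zero k p _ h3b)
  exact mem_of_natCast_mul_mem k hN (Ideal.span T) 1 (by rwa [mul_one])

/-- `f = X₄² + X_i³ + X_j³ + B ≠ 0` when `B` has no constant term... — we only need it under `Prime f`. [plumbing] -/
theorem ne_zero_of_prime (f : MvPolynomial (Fin 5) k) (hprime : Prime f) : f ≠ 0 := hprime.ne_zero

/-- **The FULL clause at EVERY maximal ideal of `k[X]/(f)`**, `f = X₄² + X_i³ + X_j³ + B` as above, `f ≠ 0`, `p ∉ {2,3}`. [OURS · assembly] -/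
theorem clause_of_two_cubes (p : ℕ) [Fact p.Prime] [CharP k p] (hp2 : p ≠ 2) (hp3 : p ≠ 3) (i j : Fin 5) (hij : i ≠ j) (hi4 : i ≠ 4) (hj4 : j ≠ 4)
    (B : MvPolynomial (Fin 5) k) (hB4 : pderiv 4 B = 0) (hBi : pderiv i B = 0) (hBj : pderiv j B = 0)
    (f : MvPolynomial (Fin 5) k) (hf : f = X 4 ^ 2 + X i ^ 3 + X j ^ 3 + B) (hf0 : f ≠ 0)
    (Q : Ideal (MvPolynomial (Fin 5) k ⧸ Ideal.span {f})) [Q.IsMaximal] :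
    ∀ d : ℕ, ringKrullDim (Localization.AtPrime Q) = d → ∀ s : Fin d → Localization.AtPrime Q,
      (Ideal.span (Set.range s)).radical.IsMaximal →
        RingTheory.Sequence.IsWeaklyRegular (Localization.AtPrime Q) (List.ofFn s) ∧
        ∀ y : Localization.AtPrime Q, (∃ e : ℕ, y ^ p ^ e ∈ Ideal.span
          ((fun z : Localization.AtPrime Q => z ^ p ^ e) ''
            (Ideal.span (Set.range s) : Set (Localization.AtPrime Q)))) → y ∈ Ideal.span (Set.range s) :=
  TCaFloorOneFull.clause_at_maximal_of_derivative_certificate p k f hf0 (hcert_of_two_cubes k p hp2 hp3 i j hij hi4 hj4 B hB4 hBi hBj f hf) Q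

/-- ★★ **`Y = {X₄² + X_i³ + X_j³ + B = 0}` IS FULL AT EVERY CLOSED POINT** (`f` prime; `p ∉ {2,3}`): `𝒪_{Y,y}` is a domain, Cohen–Macaulay in the clause sense, and every parameter
ideal is Frobenius closed. [OURS · class-level certificate] -/
theorem fullCl_stalk_of_two_cubes (p : ℕ) [Fact p.Prime] [CharP k p] (hp2 : p ≠ 2) (hp3 : p ≠ 3) (i j : Fin 5) (hij : i ≠ j) (hi4 : i ≠ 4) (hj4 : j ≠ 4)
    (B : MvPolynomial (Fin 5) k) (hB4 : pderiv 4 B = 0) (hBi : pderiv i B = 0) (hBj : pderiv j B = 0)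
    (f : MvPolynomial (Fin 5) k) (hf : f = X 4 ^ 2 + X i ^ 3 + X j ^ 3 + B) (hprime : Prime f)
    (y : Spec (.of (MvPolynomial (Fin 5) k ⧸ Ideal.span {f}))) (hy : y.asIdeal.IsMaximal) :
    FullCl p ((Spec (.of (MvPolynomial (Fin 5) k ⧸ Ideal.span {f}))).presheaf.stalk y) := by
  haveI := (Ideal.span_singleton_prime hprime.ne_zero).mpr hprime
  haveI : IsDomain (MvPolynomial (Fin 5) k ⧸ Ideal.span {f}) := Ideal.Quotient.isDomain _
  haveI := hy
  haveI : IsDomain (Localization.AtPrime y.asIdeal) :=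
    IsLocalization.isDomain_of_le_nonZeroDivisors _ y.asIdeal.primeCompl_le_nonZeroDivisors
  have hloc : FullCl p (Localization.AtPrime y.asIdeal) :=
    ⟨inferInstance, clause_of_two_cubes k p hp2 hp3 i j hij hi4 hj4 B hB4 hBi hBj f hf hprime.ne_zero y.asIdeal⟩
  exact WFixAtNonClosedDimTwo.fullCl_of_ringEquiv p (Spec.stalkIso (.of _) y).commRingCatIsoToRingEquiv.symm hloc

/-! ## §3 The (C31) bed -/

/-- ★★★ **THE (C31) BED `Y = {x² + y³ + u³ + t³ + s³ + y²u}` IS FULL AT EVERY CLOSED POINT**, every prime `p ∉ {2,3}`, every field of characteristic `p` (two pure cubes `t³, s³`;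
`B = y³ + u³ + y²u`). [OURS · application] -/
theorem fullCl_stalk_C31 (p : ℕ) [Fact p.Prime] [CharP k p] (hp2 : p ≠ 2) (hp3 : p ≠ 3) (f : MvPolynomial (Fin 5) k)
    (hf : f = X 4 ^ 2 + X 0 ^ 3 + X 1 ^ 3 + X 2 ^ 3 + X 3 ^ 3 + X 0 ^ 2 * X 1)
    (y : Spec (.of (MvPolynomial (Fin 5) k ⧸ Ideal.span {f}))) (hy : y.asIdeal.IsMaximal) :
    FullCl p ((Spec (.of (MvPolynomial (Fin 5) k ⧸ Ideal.span {f}))).presheaf.stalk y) := by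
  have h3 : (3 : k) ≠ 0 := (X2Cubic4Specimen.two_three_ne_zero k p hp2 hp3).2
  have hf' : f = X 4 ^ 2 + X 2 ^ 3 + X 3 ^ 3 + (X 0 ^ 3 + X 1 ^ 3 + X 0 ^ 2 * X 1) := by rw [hf]; ring
  refine fullCl_stalk_of_two_cubes k p hp2 hp3 2 3 (by decide) (by decide) (by decide) (X 0 ^ 3 + X 1 ^ 3 + X 0 ^ 2 * X 1) ?_ ?_ ?_ f hf'
    (X2C31Specimen.prime_f k h3 f hf) y hy
  · simp only [map_add, Derivation.leibniz, Derivation.leibniz_pow, pderiv_X_of_ne (show (0 : Fin 5) ≠ 4 by decide), pderiv_X_of_ne (show (1 : Fin 5) ≠ 4 by decide),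
      smul_zero, add_zero]
  · simp only [map_add, Derivation.leibniz, Derivation.leibniz_pow, pderiv_X_of_ne (show (0 : Fin 5) ≠ 2 by decide), pderiv_X_of_ne (show (1 : Fin 5) ≠ 2 by decide),
      smul_zero, add_zero]
  · simp only [map_add, Derivation.leibniz, Derivation.leibniz_pow, pderiv_X_of_ne (show (0 : Fin 5) ≠ 3 by decide), pderiv_X_of_ne (show (1 : Fin 5) ≠ 3 by decide),
      smul_zero, add_zero]

/-- ★★★ **THE VERTEX OF THE (C31) BED IS FULL** (`p ∉ {2,3}`): with ✓ `X2C31ClassRow.tStep_row_C31` (scope: `v` closed, singular, `dim 𝒪_{Y,v} = 4`) the base germ of the (C31) row is a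
LEGAL input of the T″ stub. [OURS · application] -/
theorem fullCl_Spec_stalk_vertex_C31 (p : ℕ) [Fact p.Prime] [CharP k p] (hp2 : p ≠ 2) (hp3 : p ≠ 3) (f : MvPolynomial (Fin 5) k)
    (hf : f = X 4 ^ 2 + X 0 ^ 3 + X 1 ^ 3 + X 2 ^ 3 + X 3 ^ 3 + X 0 ^ 2 * X 1)
    (v : Spec (.of (MvPolynomial (Fin 5) k ⧸ Ideal.span {f})))
    (hv : v.asIdeal = Ideal.span (Set.range fun j : Fin 5 => Ideal.Quotient.mk (Ideal.span {f}) (X j))) :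
    FullCl p ((Spec (.of (MvPolynomial (Fin 5) k ⧸ Ideal.span {f}))).presheaf.stalk v) := by
  refine fullCl_stalk_C31 k p hp2 hp3 f hf v ?_
  rw [hv]
  exact DoublePointFermatCubicGerm.isMaximal_origin k f (X2C31Specimen.constantCoeff_f k f hf)

end Summit.ResolutionOfSingularities.ResolutionOfSingularities.Theorems.FInjectiveMacaulayfication.X2TwoCubesVertexFull

end
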